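import Summits.ResolutionOfSingularities.ResolutionOfSingularities.Theorems.EquisingularLiftEquisingularLiftNatExceptionalReduced
import Summits.ResolutionOfSingularities.ResolutionOfSingularities.Theorems.EquisingularLiftEquisingularLiftNatCarrierDeltaComapFrame
import Mathlib.RingTheory.Polynomial.Quotient
import HarnessLib

/-!
# [OURS · L1 W4.5(b) · EL♮(3)] THE NEW EXCEPTIONAL SURFACE HAS EXACT REDUCED TRACE — model-square form
# `((C·𝒪_{X₁})·𝒪_{G₁}) = 𝓘⟨υ⁻¹ Z⟩` for the blow-up of a centre `C` with QUASI-REGULAR frames UPSTAIRS and reduced trace `C·𝒪_G = 𝓘⟨Z⟩`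
# (tower assembly HSUB′(ReachTower₀)₃: clause (e-i) of `Tower.Inv₁` at the curve step and at cone rounds with NODAL centres)

res-D-pv-029 g8 (HSUB′(ReachTower)₃ ASSEMBLY, res-L1-w45b-plan-1 NAMING 2026-08-27T16:17:51Z). OURS; NOT a statement of any manuscript;
AI-written, weaker than expert review. No `sorry`; standard axioms. DEF-FREE. `--supports stmt-ResolutionOfSingularities-20148 --as helper`.

WHY A SECOND FORM (my STATUS 17:50Z caveat). …NatExceptionalReduced (`comap_vanishingIdeal_eq_vanishingIdeal_preimage`, p552426) needs
the DOWNSTAIRS centre `𝓘⟨Z⟩` to be quasi-regular at each point; at a NODE of `Z` (the carrier `Z₉` keeps its finitely many singular points;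
a nodal cone witness `E ∩ closure K`) this is a Cohen–Macaulay statement about the special fibre the tree cannot phrase cheaply. In the model
square the UPSTAIRS centre `C` is REGULAR, hence has quasi-regular frames at every point (Literature
`exists_isQuasiRegular_span_eq_of_isRegularLocalRing_quotient`), and that suffices:

* `comap_comap_eq_vanishingIdeal_preimage_of_model` — model squares `jG : G → X`, `j₁ : G₁ → X₁` over `Spec θ` (`θ : O ↠ k`, `O` a DVR),
  `τ : X₁ → X` the blow-up of `C`, `υ : G₁ → G` with `j₁ ≫ τ = υ ≫ jG`, `C·𝒪_G = 𝓘⟨Z⟩` (reduced trace), quasi-regular frames of `C` at the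
  special points of its support ⟹ `(C.comap τ).comap j₁ = 𝓘⟨υ⁻¹ Z⟩`: the exceptional surface `V((C·𝒪_{X₁})·𝒪_{G₁})` is REDUCED.
  PROOF, stalk at `x' ∈ G₁` over `p = τ(j₁ x') ∈ supp C`: `𝒪_{X₁,j₁x'} ≅ B_𝔔`, `B = 𝒪_{X,p}[C_p/c_j]`, `(C·𝒪_{X₁})_{j₁x'} = (c_j/1)`
  (`exists_blowupAlgebra_stalk_ringEquiv_of_eq`); `𝒪_{G₁,x'} = 𝒪_{X₁,j₁x'}/(ϖ)` (`stalkMap_model_surjective`, `ker_stalkMap_model_le`,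
  `stalkMap_model_varpi`, res-type-100 …NatCarrierDeltaComapFrame); `B/(c_j/1, ϖ) ≅ (𝒪_{X,p}/(C_p + ϖ))[T_l : l ≠ j]` (Stacks 0BIQ
  `blowupAlgebraQuotEquiv` + `MvPolynomial.quotientEquivQuotientMvPolynomial`) and `𝒪_{X,p}/(C_p + ϖ) ≅ 𝒪_{G,z}/𝓘⟨Z⟩_z` is REDUCED —
  so `((c_j/1, ϖ))` is radical in `B`, in `B_𝔔 ≅ 𝒪_{X₁,j₁x'}`, and its image `(C·𝒪_{X₁})·𝒪_{G₁,x'}` under the surjection with kernel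
  `(ϖ)` is radical (`Ideal.map_radical_of_surjective`).
* the three ring-theoretic steps are isolated as `isReduced_quotient_sup_of_surjective`, `isReduced_quotient_sup_span_of_mvPolynomial`,
  `isRadical_map_map_of_ker_le`; the model-fibre step as `isReduced_stalk_quotient_sup_varpi_of_model`.

References: [cite: StacksProject, Tag 0BIQ]; [cite: Liu2002, Thm. 8.1.19 (b)]; tree inputs as named.
-/

set_option linter.dupNamespace false -- mandated namespace `Summit.<Summit>.<Problem>` of this single-conjunct summit
set_option linter.overlappingInstances false -- signatures carry `[IsDomain O] [IsDiscreteValuationRing O]`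

noncomputable section

open CategoryTheory AlgebraicGeometry TopologicalSpace IsLocalRing
open Literature.AlgebraicGeometry.Resolution
open AlgebraicGeometry.Scheme.IdealSheafData
open Summit.ResolutionOfSingularities.ResolutionOfSingularities.Cruxes.EquisingularLift.StrataSplit

namespace Summit.ResolutionOfSingularities.ResolutionOfSingularities.Cruxes.EquisingularLiftNat.Sections

universe u

/-! ## Ring-theoretic steps -/

/-- `A ⧸ (I ⊔ (a))` is reduced if `A → R` is surjective with kernel inside `(a)`, kills `a`, and `R ⧸ I·R` is reduced. [folklore] -/
theorem isReduced_quotient_sup_of_surjective {A R : Type u} [CommRing A] [CommRing R] (g : A →+* R) (hg : Function.Surjective g)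
    (I : Ideal A) (a : A) (hker : RingHom.ker g ≤ Ideal.span {a}) (hga : g a = 0) [hR : IsReduced (R ⧸ I.map g)] :
    IsReduced (A ⧸ (I ⊔ Ideal.span {a})) := by
  -- `A ⧸ (I ⊔ (a)) ≅ R ⧸ I·R`: the composite `A → R ⧸ I·R` is surjective with kernel `I ⊔ ker g = I ⊔ (a)`
  have hka : RingHom.ker g = Ideal.span {a} :=
    le_antisymm hker ((Ideal.span_singleton_le_iff_mem _).mpr hga)
  set φ : A →+* R ⧸ I.map g := (Ideal.Quotient.mk (I.map g)).comp g with hφ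
  have hφs : Function.Surjective φ := Ideal.Quotient.mk_surjective.comp hg
  have hkφ : RingHom.ker φ = I ⊔ Ideal.span {a} := by
    rw [hφ, ← RingHom.comap_ker, Ideal.mk_ker, Ideal.comap_map_of_surjective' g hg, hka]
  rw [← hkφ]
  exact isReduced_of_injective (RingHom.quotientKerEquivOfSurjective hφs).toRingHom
    (RingHom.quotientKerEquivOfSurjective hφs).injective

/-- `B ⧸ ((b) ⊔ (ι a))` is reduced if `B ⧸ (b) ≅ (A ⧸ I)[T_σ]` with constants `ι r ↦ C r̄` and `A ⧸ (I ⊔ (a))` is reduced. [folklore] -/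
theorem isReduced_quotient_sup_span_of_mvPolynomial {A B : Type u} [CommRing A] [CommRing B] (ι : A →+* B) (I : Ideal A) (b : B)
    {σ : Type u} (e : MvPolynomial σ (A ⧸ I) ≃+* B ⧸ Ideal.span {b})
    (he : ∀ r : A, e (MvPolynomial.C (Ideal.Quotient.mk I r)) = Ideal.Quotient.mk _ (ι r)) (a : A)
    [hA : IsReduced (A ⧸ (I ⊔ Ideal.span {a}))] : IsReduced (B ⧸ (Ideal.span {b} ⊔ Ideal.span {ι a})) := by
  -- `(A ⧸ I) ⧸ (ā) ≅ A ⧸ (I ⊔ (a))` is reduced, hence so is the polynomial ring over it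
  set J : Ideal (A ⧸ I) := (Ideal.span {a}).map (Ideal.Quotient.mk I) with hJ
  haveI : IsReduced ((A ⧸ I) ⧸ J) :=
    isReduced_of_injective (DoubleQuot.quotQuotEquivQuotSup I (Ideal.span {a})).toRingHom
      (DoubleQuot.quotQuotEquivQuotSup I (Ideal.span {a})).injective
  haveI : IsReduced (MvPolynomial σ ((A ⧸ I) ⧸ J)) := inferInstance
  -- `(A ⧸ I)[T] ⧸ C(J) ≅ ((A ⧸ I) ⧸ J)[T]`
  haveI hP : IsReduced (MvPolynomial σ (A ⧸ I) ⧸ (Ideal.map MvPolynomial.C J : Ideal (MvPolynomial σ (A ⧸ I)))) :=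
    isReduced_of_injective (MvPolynomial.quotientEquivQuotientMvPolynomial (σ := σ) J).symm.toRingEquiv.toRingHom
      (MvPolynomial.quotientEquivQuotientMvPolynomial (σ := σ) J).symm.injective
  -- transport along `e`: the ideal `C(J)` goes to `(b̄-class of ι a)`
  have hJC : (Ideal.map MvPolynomial.C J : Ideal (MvPolynomial σ (A ⧸ I))) =
      Ideal.span {MvPolynomial.C (Ideal.Quotient.mk I a)} := by
    rw [hJ, Ideal.map_map, Ideal.map_span, Set.image_singleton]; rfl
  have hιa : (Ideal.span {MvPolynomial.C (Ideal.Quotient.mk I a)} : Ideal (MvPolynomial σ (A ⧸ I))).map (e : _ →+* _) =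
      Ideal.span {Ideal.Quotient.mk (Ideal.span {b}) (ι a)} := by
    rw [Ideal.map_span, Set.image_singleton, RingHom.coe_coe, he]
  -- `(B ⧸ (b)) ⧸ (ι a) ≅ B ⧸ ((b) ⊔ (ι a))`
  have e₂ : (MvPolynomial σ (A ⧸ I) ⧸ (Ideal.map MvPolynomial.C J : Ideal (MvPolynomial σ (A ⧸ I)))) ≃+*
      (B ⧸ Ideal.span {b}) ⧸ Ideal.span {Ideal.Quotient.mk (Ideal.span {b}) (ι a)} :=
    Ideal.quotientEquiv _ _ e (by rw [hJC, hιa])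
  have e₃ : (B ⧸ Ideal.span {b}) ⧸ Ideal.span {Ideal.Quotient.mk (Ideal.span {b}) (ι a)} ≃+*
      B ⧸ (Ideal.span {b} ⊔ Ideal.span {ι a}) := by
    have : Ideal.span {Ideal.Quotient.mk (Ideal.span {b}) (ι a)} = (Ideal.span {ι a}).map (Ideal.Quotient.mk (Ideal.span {b})) := by
      rw [Ideal.map_span, Set.image_singleton]
    rw [this]
    exact DoubleQuot.quotQuotEquivQuotSup _ _
  exact isReduced_of_injective (e₂.trans e₃).symm.toRingHom (e₂.trans e₃).symm.injective

/-- Radical ideals pass along `χ : B → T` (a localisation up to the iso `e`) and then along a surjection `f : T → U` whose kernel is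
generated by an element of the ideal. [folklore] -/
theorem isRadical_map_map_of_ker_le {B S T U : Type u} [CommRing B] [CommRing S] [CommRing T] [CommRing U] [Algebra B S]
    (M : Submonoid B) [IsLocalization M S] (e : T ≃+* S) (χ : B →+* T) (hχ : ∀ b, e (χ b) = algebraMap B S b)
    (f : T →+* U) (hf : Function.Surjective f) {K : Ideal B} (hK : K.IsRadical) (w : B) (hwK : w ∈ K)
    (hker : RingHom.ker f ≤ Ideal.span {χ w}) : ((K.map χ).map f).IsRadical := by
  have h1 : (K.map χ).IsRadical := isRadical_map_of_isLocalization_of_ringEquiv (S := S) M e χ hχ hK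
  have hker' : RingHom.ker f ≤ K.map χ :=
    hker.trans ((Ideal.span_singleton_le_iff_mem _).mpr (Ideal.mem_map_of_mem χ hwK))
  intro x hx
  rw [← Ideal.map_radical_of_surjective hf hker', h1.radical] at hx
  exact hx

/-! ## The model fibre: `𝒪_{X,jG z} ⧸ (C_{jG z} + ϖ) ≅ 𝒪_{G,z} ⧸ 𝓘⟨Z⟩_z` is reduced -/

/-- In a model square over a DVR with uniformiser `ϖ`, if `C·𝒪_G = 𝓘⟨Z⟩` then `𝒪_{X,jG z} ⧸ (C_{jG z} ⊔ (ϖ))` is reduced. [folklore] -/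
theorem isReduced_stalk_quotient_sup_varpi_of_model (O : Type) [CommRing O] [IsDomain O] [IsDiscreteValuationRing O]
    (k : Type) [Field k] (θ : O →+* k) (hθ : Function.Surjective θ) {X G : Scheme.{0}} (r : X ⟶ Spec (.of O))
    (jG : G ⟶ X) (tG : G ⟶ Spec (.of k)) (hsq : IsPullback jG tG r (Spec.map (CommRingCat.ofHom θ)))
    (ϖ : O) (hϖ : Irreducible ϖ) (C : X.IdealSheafData) (Z : Closeds G) (hCZ : C.comap jG = vanishingIdeal Z) (z : G) :
    IsReduced (X.presheaf.stalk (jG z) ⧸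
      (stalkIdeal C (jG z) ⊔ Ideal.span {(X.presheaf.Γgerm (jG z)).hom (r.appTop.hom ((Scheme.ΓSpecIso (.of O)).inv.hom ϖ))})) := by
  haveI : IsReduced (G.presheaf.stalk z ⧸ (stalkIdeal C (jG z)).map (jG.stalkMap z).hom) := by
    rw [← stalkIdeal_comap_eq_map_stalkMap, hCZ, ← Ideal.isRadical_iff_quotient_reduced]
    haveI := ComponentGluing.isReduced_subscheme_vanishingIdeal Z
    exact isRadical_stalkIdeal_of_isReduced_subscheme (vanishingIdeal Z) z
  exact isReduced_quotient_sup_of_surjective (jG.stalkMap z).hom (stalkMap_model_surjective θ hθ r jG tG hsq z)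
    (stalkIdeal C (jG z)) _ (ker_stalkMap_model_le O k θ hθ r jG tG hsq z ϖ hϖ)
    (stalkMap_model_varpi θ hθ r jG tG hsq z ϖ (hϖ.maximalIdeal_eq ▸ Ideal.mem_span_singleton_self ϖ))

/-! ## The new exceptional surface is reduced -/

set_option maxHeartbeats 800000 in -- chart algebra `blowupAlgebra` = subalgebra of a localisation: slow unification (as p509910)
/-- **The exceptional surface of a model step has exact reduced trace.** See the module docstring.
[cite: StacksProject, Tag 0BIQ] [cite: Liu2002, Thm. 8.1.19 (b)] [OURS · L1 W4.5b] tower assembly, `Tower.Inv₁` (e-i) at the curve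
step and at cone rounds. -/
theorem comap_comap_eq_vanishingIdeal_preimage_of_model (O : Type) [CommRing O] [IsDomain O] [IsDiscreteValuationRing O]
    (k : Type) [Field k] (θ : O →+* k) (hθ : Function.Surjective θ)
    {X X₁ G G₁ : Scheme.{0}} (r : X ⟶ Spec (.of O)) [IsLocallyNoetherian X₁]
    (jG : G ⟶ X) (tG : G ⟶ Spec (.of k)) (hsq : IsPullback jG tG r (Spec.map (CommRingCat.ofHom θ)))
    (C : X.IdealSheafData) (τ : X₁ ⟶ X) (hτ : IsBlowup τ C)
    (j₁ : G₁ ⟶ X₁) (t₁ : G₁ ⟶ Spec (.of k)) (hsq₁ : IsPullback j₁ t₁ (τ ≫ r) (Spec.map (CommRingCat.ofHom θ)))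
    (υ : G₁ ⟶ G) (hcomm : j₁ ≫ τ = υ ≫ jG)
    (Z : Closeds G) (hCZ : C.comap jG = vanishingIdeal Z)
    (hqr : ∀ z ∈ (Z : Set G), ∃ (n : ℕ) (c : Fin n → X.presheaf.stalk (jG z)),
      Ideal.span (Set.range c) = stalkIdeal C (jG z) ∧ IsQuasiRegular c) :
    (C.comap τ).comap j₁ = vanishingIdeal (Z.preimage υ.continuous) := by
  classical
  obtain ⟨ϖ, hϖ⟩ := IsDiscreteValuationRing.exists_irreducible O
  have hJ : (C.comap τ).comap j₁ = (vanishingIdeal Z).comap υ := by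
    rw [← Scheme.IdealSheafData.comap_comp, hcomm, Scheme.IdealSheafData.comap_comp, hCZ]
  rw [vanishingIdeal_preimage, ← hJ]
  refine ext_of_forall_stalkIdeal_eq fun x' => ?_
  rw [stalkIdeal_radical]
  refine (Ideal.IsRadical.radical ?_).symm
  by_cases hz : υ x' ∈ (Z : Set G)
  · -- the point `p = jG (υ x') = τ (j₁ x')` of the centre
    have hp : τ (j₁ x') = jG (υ x') := by rw [← Scheme.Hom.comp_apply, hcomm, Scheme.Hom.comp_apply]
    -- quasi-regular frame of `C` at `p`, transported to the literal point `τ (j₁ x')`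
    have hqr' : ∃ (n : ℕ) (c : Fin n → X.presheaf.stalk (τ (j₁ x'))),
        Ideal.span (Set.range c) = stalkIdeal C (τ (j₁ x')) ∧ IsQuasiRegular c := by
      rw [hp]; exact hqr _ hz
    obtain ⟨n, c, hc, hq⟩ := hqr'
    obtain ⟨j, 𝔔, χ, e, hχ, he, -⟩ :=
      exists_blowupAlgebra_stalk_ringEquiv_of_eq hτ (j₁ x') c (Ideal.span (Set.range c)) rfl hc
    -- the stalk of the exceptional ideal upstairs: `(χ (c_j/1))`
    have hstalkMap : (τ.stalkMap (j₁ x')).hom = χ.comp (algebraMap _ (blowupAlgebra (Ideal.span (Set.range c)) (c j))) :=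
      RingHom.ext fun a => (hχ a).symm
    have hE : stalkIdeal (C.comap τ) (j₁ x') =
        (Ideal.span {algebraMap _ (blowupAlgebra (Ideal.span (Set.range c)) (c j)) (c j)}).map χ := by
      rw [stalkIdeal_comap_eq_map_stalkMap, ← hc, hstalkMap, ← Ideal.map_map,
        map_blowupAlgebra_eq_span (Ideal.subset_span (Set.mem_range_self j))]
    -- the uniformiser germ at `p` and its behaviour
    set ϖp : X.presheaf.stalk (τ (j₁ x')) :=
      (X.presheaf.Γgerm (τ (j₁ x'))).hom (r.appTop.hom ((Scheme.ΓSpecIso (.of O)).inv.hom ϖ)) with hϖp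
    -- `B ⧸ ((c_j/1) ⊔ (ϖ/1))` is reduced
    have hred : IsReduced (X.presheaf.stalk (τ (j₁ x')) ⧸ (Ideal.span (Set.range c) ⊔ Ideal.span {ϖp})) := by
      rw [hc, hϖp, hp]
      exact isReduced_stalk_quotient_sup_varpi_of_model O k θ hθ r jG tG hsq ϖ hϖ C Z hCZ (υ x')
    haveI := hred
    haveI hBred : IsReduced (blowupAlgebra (Ideal.span (Set.range c)) (c j) ⧸
        (Ideal.span {algebraMap _ (blowupAlgebra (Ideal.span (Set.range c)) (c j)) (c j)} ⊔
          Ideal.span {algebraMap _ (blowupAlgebra (Ideal.span (Set.range c)) (c j)) ϖp})) :=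
      isReduced_quotient_sup_span_of_mvPolynomial (algebraMap _ (blowupAlgebra (Ideal.span (Set.range c)) (c j)))
        (Ideal.span (Set.range c)) _ (blowupAlgebraQuotEquiv c j hq) (blowupAlgebraQuotEquiv_C c j hq) ϖp
    have hKrad : (Ideal.span {algebraMap _ (blowupAlgebra (Ideal.span (Set.range c)) (c j)) (c j)} ⊔
        Ideal.span {algebraMap _ (blowupAlgebra (Ideal.span (Set.range c)) (c j)) ϖp}).IsRadical :=
      (Ideal.isRadical_iff_quotient_reduced _).mpr hBred
    -- downstairs: the kernel of `j₁^♯` is generated by the germ of `ϖ` upstairs, `= χ (ϖ/1)`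
    have hϖup : (X₁.presheaf.Γgerm (j₁ x')).hom ((τ ≫ r).appTop.hom ((Scheme.ΓSpecIso (.of O)).inv.hom ϖ)) =
        χ (algebraMap _ (blowupAlgebra (Ideal.span (Set.range c)) (c j)) ϖp) := by
      rw [hχ, hϖp, stalkMap_Γgerm_apply', Scheme.Hom.comp_appTop]; rfl
    have hker : RingHom.ker (j₁.stalkMap x').hom ≤
        Ideal.span {χ (algebraMap _ (blowupAlgebra (Ideal.span (Set.range c)) (c j)) ϖp)} := by
      rw [← hϖup]; exact ker_stalkMap_model_le O k θ hθ (τ ≫ r) j₁ t₁ hsq₁ x' ϖ hϖ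
    -- conclude
    rw [stalkIdeal_comap_eq_map_stalkMap, hE]
    have hsub : ((Ideal.span {algebraMap _ (blowupAlgebra (Ideal.span (Set.range c)) (c j)) (c j)}).map χ).map
        (j₁.stalkMap x').hom =
        ((Ideal.span {algebraMap _ (blowupAlgebra (Ideal.span (Set.range c)) (c j)) (c j)} ⊔
          Ideal.span {algebraMap _ (blowupAlgebra (Ideal.span (Set.range c)) (c j)) ϖp}).map χ).map (j₁.stalkMap x').hom := by
      rw [Ideal.map_sup, Ideal.map_sup, Ideal.map_span _ {algebraMap _ _ ϖp}, Set.image_singleton, Ideal.map_span _ {χ _},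
        Set.image_singleton, ← hϖup,
        stalkMap_model_varpi θ hθ (τ ≫ r) j₁ t₁ hsq₁ x' ϖ (hϖ.maximalIdeal_eq ▸ Ideal.mem_span_singleton_self ϖ),
        Ideal.span_singleton_zero, sup_bot_eq]
    rw [hsub]
    exact isRadical_map_map_of_ker_le (S := Localization.AtPrime 𝔔.asIdeal) 𝔔.asIdeal.primeCompl e χ he
      (j₁.stalkMap x').hom (stalkMap_model_surjective θ hθ (τ ≫ r) j₁ t₁ hsq₁ x') hKrad _
      (Ideal.mem_sup_right (Ideal.mem_span_singleton_self _)) hker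
  · have hx' : x' ∉ ((C.comap τ).comap j₁).support := by
      rw [hJ, support_comap]; exact hz
    rw [stalkIdeal_eq_top_of_not_mem_support hx']
    exact fun _ _ => Submodule.mem_top

end Summit.ResolutionOfSingularities.ResolutionOfSingularities.Cruxes.EquisingularLiftNat.Sections

end
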